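import Summits.CriticalPhenomena.PercolationContinuityZ3.Theorems.FK.Transplant.KNFreeTargetStepIV
import Summits.CriticalPhenomena.PercolationContinuityZ3.Theorems.FK.Transplant.KNFreeExchangeInequality
import Summits.CriticalPhenomena.PercolationContinuityZ3.Theorems.FK.Transplant.KNFreeSeedsFkLaw
import Summits.CriticalPhenomena.PercolationContinuityZ3.Theorems.FK.GibbsOneEdgeEnergy
import HarnessLib

/-!
# FRONTIER TRANSPLANT, binder 2 (TP_FK) research line: Kozma–Nitzan Lemma 10, STEP V, for the law of record
# `fkLaw Λ W q` (`q ≥ 1`) — the exchange inequality replaces the independence (26); the relay look is the free thin-shell look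

Support file (`--supports stmt-CriticalPhenomena-4575`, helper) of the FRONTIER TRANSPLANT sub-cell
(`fk-continuity/transplant/`, seat `prim-bschramm-fkt-p3`); builds on p205010 (kernel theorem, internal audit signed;
external expert review pending). No definitions, no named facts, no sorries; standard axioms. Registered R55 (cell INBOX,
2026-08-22); lead label FT-10g (L13); registry row T2b; KERNEL FACT OF RECORD for row 2 (CHAIN-MAP §D third addendum / §H(8)).

HONEST FRAMING (page 1, cell rule). The transplant's theorem of record `ufsc0_of_freeBoundaryHypothesis_r3`
(p248245) is CONDITIONAL on FH AND on TP_FK = `KNFreeTargetHittable d q p`, both OPEN at the same `p` for `q > 1`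
(⇔ GRC Conj. (5.103) via K1; barrier note `Literature.Barriers.CriticalPhenomena.SamePFreeBoundaryCriteria`,
FBN-01, cited first); the transplant is a typed reduction, not a proof of FK continuity. THIS FILE is an
unconditional lemma toward binder 2: it does NOT prove `KNFreeTargetHittable d q p` and says nothing at
`p ↓ p_c(q)`. It is Step V (KN pp. 21–22) of Kozma–Nitzan's Lemma 10 for the random-cluster law:

* `stepV_in_fkLaw` — the tree's `LHyp.stepV_in` VERBATIM for `fkLaw Λ W q`, `1 ≤ q`, `0 < p`, with two changes of
  HYPOTHESIS and none of conclusion: (a) Steps II–III enter as `hG : φ(𝒢) > 1 - 3δ` (discharged for `fkLaw` by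
  the landed law-generic engine `KNFree.exists_level_real_Gev_gt`, FT-03c); (b) the Step-IV input `hIV` is read
  under the FREE THIN-SHELL law `φ_{restrW S W, q}` (supplied by `stepIV_in_fkLaw_of_comparison`). In the proof
  the `q = 1` independence `P_{K_ξ}(F_P) = P_G(F_P)` (KN (26); tree `hFx_pin`) is replaced by the EXCHANGE
  INEQUALITY `φ_W(F_x ∩ Ξ_xᶜ) ≤ φ_{free shell}(Ξ_xᶜ) · φ_W(F_x)` — conditioning on the OFF-shell pattern is pinning
  (Grimmett Thm. (3.7), `isPinningLaw_fkLaw`), the all-closed off-shell pinning is the free thin-shell law and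
  maximises the decreasing shell event `Ξ_xᶜ` = "no good relay on `U(x)`" ((3.22)) — this is T2a, the KERNEL
  FACT OF RECORD `fkLaw_real_inter_le_pinW_empty_of_isLowerSet` (`KNFreeExchangeInequality.lean`, fkt-p1, R54,
  p323819; CHAIN-MAP §H(7)), consumed here; then the summation runs through `Σ_x φ(F_x ∩ Ξ_x)` and the tower property of pinning
  (`IsPinningLaw.real_inter_eq_sum_pinW`). NO wall-type look is needed at the relay-selection step (the point
  recorded as CONTESTED in the docstring of `KNFreeTargetHittable`, FT04-DESIGN §3(b)): the only look is the
  free THIN-SHELL look `hIV`.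
* bookkeeping: `fkLaw_congr_of_forall`, `seedE_subset_pairsF`, `determinedBy_oSeed_pairsF`, `determinedBy_Fx_pairsF`
  (first-open-seed events are `pairsF Sfin`-determined; index splice = the landed `DeterminedBy.inter_index`, FK/GibbsOneEdgeEnergy).

## References

* G. Kozma, S. Nitzan, arXiv:2401.12397 (2024), §4 Lemma 10, Step V, eq. (26) (pp. 21–22) [KozmaNitzan2024].
* G. Grimmett, *The Random-Cluster Model*, Springer 2006, Thm. (3.7) (p. 39), Thm. (3.21) eq. (3.22) [Grimmett2006].
-/

noncomputable section

open MeasureTheory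
open scoped ENNReal Classical

namespace Summit.CriticalPhenomena.PercolationContinuityZ3.Theorems.FK

open Literature.Probability.Percolation Literature.Probability.LatticeModels SimpleGraph
open Literature.Probability.Percolation.KozmaNitzan Transplant

variable {d : ℕ}

/-! ### Generic bookkeeping -/

/-- `fkLaw Λ W q` only reads the weights of the pairs with both endpoints in `Λ`. [cite: Grimmett2006, §1.4 eq. (1.20)] -/
theorem fkLaw_congr_of_forall {Λ : Finset (Site d)} {W W' : Sym2 (Site d) → unitInterval} (q : ℝ)
    (h : ∀ e : Sym2 (Site d), (∀ z ∈ e, z ∈ Λ) → W e = W' e) : fkLaw Λ W q = fkLaw Λ W' q := by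
  unfold fkLaw
  have : (fun e : Sym2 ↥Λ => W (Sym2.map Subtype.val e)) = fun e : Sym2 ↥Λ => W' (Sym2.map Subtype.val e) := by
    funext e
    refine h _ fun z hz => ?_
    obtain ⟨y, -, rfl⟩ := Sym2.mem_map.1 hz
    exact y.2
  rw [this]

/-! ### The first-open-seed events are determined by the pairs inside `Sfin` (for `0 < p`) -/

section Seeds

variable {L : LData d} {W : Sym2 (Site d) → unitInterval} {p : unitInterval} {D : Finset (Site d)} {R : ℕ}

/-- Seed edges are pairs inside `Sfin` (they carry weight `p ≠ 0`; finite support). [cite: KozmaNitzan2024, §4 p. 19 (seeds)] -/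
theorem seedE_subset_pairsF [NeZero d] (hL : LHyp L W p D R) (hp0 : 0 < (p : ℝ)) {j M : ℕ} (hj : j ≤ R)
    (hwide : ∀ k, L.Lo j k + 2 * M + 2 ≤ L.Hi j k) {x : Site d} (hx : x ∈ outerBoundary (zdGraph d) (L.X j)) :
    L.seedE j M x ⊆ pairsF L.Sfin := by
  intro e he
  have hW : W e = p := hL.W_seedE hj hwide hx he
  have hne : W e ≠ 0 := by
    intro h0
    have : ((W e : unitInterval) : ℝ) = 0 := by rw [h0]; rfl
    rw [hW] at this; exact hp0.ne' this
  have hmem := KNFree.forall_mem_of_finSupp hL.fin hne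
  obtain ⟨hedge, -, -, -⟩ := LData.mem_seedE hwide hx he
  simp only [pairsF, Finset.mem_filter, Finset.mem_sym2_iff]
  refine ⟨hmem, ?_⟩
  induction e using Sym2.ind with
  | h a b => rw [SimpleGraph.mem_edgeSet] at hedge; rw [Sym2.mk_isDiag_iff]; exact hedge.ne

/-- `oSeed x` is determined by the pairs inside `Sfin`. [cite: KozmaNitzan2024, §4 p. 19 (the events F_P)] -/
theorem determinedBy_oSeed_pairsF [NeZero d] (hL : LHyp L W p D R) (hp0 : 0 < (p : ℝ)) {j M k : ℕ} (hj : j ≤ R)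
    (hwide : ∀ k, L.Lo j k + 2 * M + 2 ≤ L.Hi j k) {x : Site d} (hx : x ∈ outerBoundary (zdGraph d) (L.X j)) :
    DeterminedBy (L.oSeed j M k x) (↑(pairsF L.Sfin) : Set (Sym2 (Site d))) := by
  rw [determinedBy_iff]
  intro ω ω' hω
  have hag : ∀ e ∈ pairsF L.Sfin, e ∈ ω ↔ e ∈ ω' := fun e he => by
    have := Set.ext_iff.1 hω e
    simp only [Set.mem_inter_iff, Finset.mem_coe] at this
    exact ⟨fun h' => (this.1 ⟨h', he⟩).1, fun h' => (this.2 ⟨h', he⟩).1⟩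
  have hreg : ∀ e ∈ wireSet (L.region j), e ∈ ω ↔ e ∈ ω' := fun e he =>
    hag e (by have := L.wireSet_region_subset j he; exact_mod_cast this)
  have hseed := seedE_subset_pairsF hL hp0 hj hwide hx (M := M)
  simp only [LData.oSeed, Set.mem_inter_iff, Set.mem_setOf_eq, LData.sel, LData.Kont_congr hreg, LData.SeedOpen]
  refine and_congr_right fun _ => ⟨fun h' e he => (hag e (hseed he)).1 (h' he), fun h' e he => (hag e (hseed he)).2 (h' he)⟩

/-- `F_x` is determined by the pairs inside `Sfin`. [cite: KozmaNitzan2024, §4 p. 19 (the events F_P)] -/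
theorem determinedBy_Fx_pairsF [NeZero d] (hL : LHyp L W p D R) (hp0 : 0 < (p : ℝ)) {j M k : ℕ} (hj : j ≤ R)
    (hwide : ∀ k, L.Lo j k + 2 * M + 2 ≤ L.Hi j k) {x : Site d} (hx : x ∈ outerBoundary (zdGraph d) (L.X j)) :
    DeterminedBy (L.Fx j M k x) (↑(pairsF L.Sfin) : Set (Sym2 (Site d))) := by
  rw [determinedBy_iff]
  intro ω ω' hω
  simp only [LData.Fx, Set.mem_inter_iff, Set.mem_iInter, Set.mem_compl_iff, Finset.mem_filter]
  rw [(determinedBy_iff _ _).1 (determinedBy_oSeed_pairsF hL hp0 hj hwide hx (k := k)) ω ω' hω]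
  refine and_congr_right fun _ => forall₂_congr fun x' hx' => ?_
  rw [(determinedBy_iff _ _).1 (determinedBy_oSeed_pairsF hL hp0 hj hwide hx'.1 (k := k)) ω ω' hω]

end Seeds

/-! ### Step V for `fkLaw`, `q ≥ 1` -/

open Classical in
/-- **Kozma–Nitzan Lemma 10, Step V, for the random-cluster law `fkLaw Λ W q` (`1 ≤ q`, `0 < p`)** — the tree's
`LHyp.stepV_in` (KN pp. 21–22) with the law swapped, Steps II–III entering as `hG : φ(𝒢) > 1 - 3δ`, and the
Step-IV input read under the FREE THIN-SHELL law `φ_{restrW S W, q}`. Proof: for each potential contact `x`,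
the EXCHANGE INEQUALITY (conditioning on the off-shell pattern is pinning, Grimmett Thm. (3.7); the all-closed
off-shell pinning is the free thin-shell law and maximises the decreasing shell event "no good relay on `U(x)`",
(3.22)) gives `φ(F_x ∩ Ξ_x) ≥ (1-3δ)·φ(F_x)`; then `Σ_x φ(F_x ∩ Ξ_x) = Σ_ξ φ([ξ]) Σ_{x good for ξ} φ_ξ(F_x)
≤ Σ_ξ φ([ξ]) φ_ξ(o ↔ A_ξ)` (tower property of pinning; the `F_x` are disjoint and `F_x ⊆ {o ↔ U(x)}`), and the
rest — bad patterns have mass `≤ ε/2`, gluing `hC3` in each good `K_ξ`, total probability — is the printed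
argument. [cite: KozmaNitzan2024, §4 pp. 21–22 (Step V, (26)); Grimmett2006, Thm. (3.7) (p. 39), eq. (3.22)] -/
theorem stepV_in_fkLaw [NeZero d] {L : LData d} {W : Sym2 (Site d) → unitInterval} {p : unitInterval}
    {D : Finset (Site d)} {R : ℕ} (hL : LHyp L W p D R) {q : ℝ} (hq : 1 ≤ q) (hp0 : 0 < (p : ℝ))
    {Λ : Finset (Site d)} (hΛ : L.Sfin ⊆ Λ)
    {Rg : Set (Site d)} {j M k : ℕ} (hj : j ≤ R) (hwide : ∀ k, L.Lo j k + 2 * M + 2 ≤ L.Hi j k)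
    {S T : Finset (Site d)} (hS : S ⊆ Finset.Icc (L.Lo j + 1) (L.Hi j - 1)) (hSD : S ⊆ D)
    {ε δ δc : ℝ} (hε : 0 < ε) (hε1 : ε ≤ 1) (hδ : 0 < δ) (hδc : δ ≤ δc)
    (h3δ : 3 * δ ≤ 1) (h12 : 12 * δ ≤ ε * δc)
    (hG : 1 - 3 * δ < (fkLaw Λ W q).real (L.Gev j M k))
    (hUS : ∀ x ∈ outerBoundary (zdGraph d) (L.X j), L.ufaceX j M x ⊆ S)
    (hIV : ∀ x ∈ outerBoundary (zdGraph d) (L.X j),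
      1 - 3 * δ ≤ (fkLaw Λ (restrW (↑S : Set (Site d)) W) q).real {ω | ∃ u ∈ L.ufaceX j M x,
        1 - δ < (fkLaw Λ (pinW W (wireSet (↑S : Set (Site d))) ω) q).real (⋃ t ∈ T, openConnIn Rg u t)})
    (hC3 : ∀ (w : Sym2 (Site d) → unitInterval), FinSupp w L.Sfin → ∀ (A : Finset (Site d)), A ⊆ L.Sfin →
      1 - δc < (fkLaw Λ w q).real (⋃ a ∈ A, openConn L.o a) →
      (∀ a ∈ A, 1 - δc < (fkLaw Λ w q).real (⋃ t ∈ T, openConnIn Rg a t)) →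
      1 - ε / 2 < (fkLaw Λ w q).real (⋃ t ∈ T, openConn L.o t)) :
    1 - ε < (fkLaw Λ W q).real (⋃ t ∈ T, openConn L.o t) := by
  have hq0 : 0 < q := one_pos.trans_le hq
  haveI : Countable (Site d) := inferInstance
  set μ := fkLaw Λ W q with hμ
  haveI hμP : IsProbabilityMeasure μ := isProbabilityMeasure_fkLaw Λ W hq0
  have hPL := isPinningLaw_fkLaw Λ hq
  set DΛ : Set (Sym2 (Site d)) := Set.range (Sym2.map (Subtype.val : ↥Λ → Site d)) with hDΛ
  set OB := outerBoundary (zdGraph d) (L.X j) with hOB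
  set F := pairsF S with hF
  have hFS : (↑F : Set (Sym2 (Site d))) = wireSet (↑S : Set (Site d)) := coe_pairsF S
  have hSfin : S ⊆ L.Sfin := hSD.trans hL.DS
  have hSΛ : S ⊆ Λ := hSfin.trans hΛ
  have hFD : (↑F : Set (Sym2 (Site d))) ⊆ DΛ := by
    rw [hFS]; exact (wireSet_mono (Finset.coe_subset.2 hSΛ)).trans (wireSet_subset_range_sym2Map Λ)
  -- the events `A u = {u ↔ T inside Rg}`
  set Aev : Site d → Set (BondConfig (Site d)) := fun u => ⋃ t ∈ T, openConnIn Rg u t with hAev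
  have hAup : ∀ u, IsUpperSet (Aev u) := fun u => isUpperSet_iUnion₂ fun t _ => isUpperSet_openConnIn Rg u t
  have hAm : ∀ u, MeasurableSet (Aev u) := fun u =>
    Finset.measurableSet_biUnion _ fun t _ => measurableSet_openConnIn_of_countable Rg u t
  -- the good shell events `Ξ_x`, the good sets `A_ξ` and the quantities `φ_ξ`
  set Good : Site d → Set (BondConfig (Site d)) := fun x => {ω | ∃ u ∈ L.ufaceX j M x,
    1 - δ < (fkLaw Λ (pinW W ↑F ω) q).real (Aev u)} with hGood
  set Aof : Finset (Sym2 (Site d)) → Finset (Site d) := fun P => S.filter fun u =>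
    1 - δ < (fkLaw Λ (pinW W ↑F ↑P) q).real (Aev u) with hAof
  set φ : Finset (Sym2 (Site d)) → ℝ := fun P =>
    (fkLaw Λ (pinW W ↑F ↑P) q).real (⋃ a ∈ Aof P, openConn L.o a) with hφ
  set cyl : Finset (Sym2 (Site d)) → Set (BondConfig (Site d)) := fun P => localCylinder ↑F ↑P with hcyl
  have hGood_det : ∀ x, DeterminedBy (Good x) ↑F := by
    intro x
    rw [determinedBy_iff]
    intro ω ω' hω
    have hag : ∀ e ∈ (↑F : Set (Sym2 (Site d))), e ∈ ω ↔ e ∈ ω' := by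
      intro e he
      have := Set.ext_iff.1 hω e
      simp only [Set.mem_inter_iff] at this
      exact ⟨fun h' => (this.1 ⟨h', he⟩).1, fun h' => (this.2 ⟨h', he⟩).1⟩
    simp only [hGood, Set.mem_setOf_eq]
    refine exists_congr fun u => and_congr_right fun _ => ?_
    rw [pinW_congr W hag]
  have hGood_m : ∀ x, MeasurableSet (Good x) := fun x => (hGood_det x).measurableSet_of_finset
  have hGood_up : ∀ x, IsUpperSet (Good x) := by
    intro x ω ω' hle
    rintro ⟨u, hu, hgood⟩
    exact ⟨u, hu, hgood.trans_le
      (fkLaw_real_mono_weights' Λ (pinW_mono_pattern W _ hle) hq (hAup u) (hAm u))⟩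
  -- Step 1 (exchange inequality): `φ(F_x ∩ Ξ_x) ≥ (1 - 3δ) φ(F_x)`
  have hexch : ∀ x ∈ OB, (1 - 3 * δ) * μ.real (L.Fx j M k x) ≤ μ.real (L.Fx j M k x ∩ Good x) := by
    intro x hx
    -- the finite off-shell pair set `F'` on which `F_x` is determined
    set F' : Finset (Sym2 (Site d)) := Λ.sym2.filter (fun e => e ∉ wireSet (↑S : Set (Site d))) with hF'
    have hF'D : (↑F' : Set (Sym2 (Site d))) ⊆ DΛ := by
      intro e he
      have he' := (Finset.mem_filter.1 (Finset.mem_coe.1 he)).1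
      exact KNFree.mem_range_sym2Map_of_forall_mem Λ (Finset.mem_sym2_iff.1 he')
    have hFxdet : DeterminedBy (L.Fx j M k x) ↑F' := by
      have h := DeterminedBy.inter_index (determinedBy_Fx_pairsF hL hp0 hj hwide hx (k := k))
        (LData.determinedBy_Fx hwide hS hx (k := k))
      refine h.mono ?_
      rintro e ⟨he1, he2⟩
      refine Finset.mem_coe.2 (Finset.mem_filter.2 ⟨Finset.mem_sym2_iff.2 fun z hz => ?_, he2⟩)
      have := (Finset.mem_filter.1 (Finset.mem_coe.1 he1)).1
      exact hΛ (Finset.mem_sym2_iff.1 this z hz)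
    -- the free thin-shell law is the all-closed off-shell pinning
    have hν : fkLaw Λ (pinW W ↑F' ∅) q = fkLaw Λ (restrW (↑S : Set (Site d)) W) q := by
      refine fkLaw_congr_of_forall q fun e he => ?_
      by_cases heS : e ∈ wireSet (↑S : Set (Site d))
      · rw [restrW_apply_of_mem _ heS, pinW_apply_of_not_mem W ∅ ?_]
        intro heF'
        exact (Finset.mem_filter.1 (Finset.mem_coe.1 heF')).2 heS
      · rw [restrW_apply_of_not_mem _ heS, pinW_apply_of_mem_of_not_mem W ?_ (Set.notMem_empty e)]
        exact Finset.mem_coe.2 (Finset.mem_filter.2 ⟨Finset.mem_sym2_iff.2 he, heS⟩)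
    haveI : IsProbabilityMeasure (fkLaw Λ (restrW (↑S : Set (Site d)) W) q) := isProbabilityMeasure_fkLaw Λ _ hq0
    have hc : (fkLaw Λ (pinW W ↑F' ∅) q).real (Good x)ᶜ ≤ 3 * δ := by
      rw [hν, measureReal_compl (hGood_m x), probReal_univ]
      have := hIV x hx
      rw [← hFS] at this
      linarith
    -- the EXCHANGE INEQUALITY, T2a `fkLaw_real_inter_le_pinW_empty_of_isLowerSet` (KN (26) for `fkLaw`)
    have h1 : μ.real ((Good x)ᶜ ∩ L.Fx j M k x) ≤ 3 * δ * μ.real (L.Fx j M k x) :=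
      (fkLaw_real_inter_le_pinW_empty_of_isLowerSet Λ hq W hF'D (hGood_up x).compl (hGood_m x).compl hFxdet).trans
        (mul_le_mul_of_nonneg_right hc measureReal_nonneg)
    have h2 : μ.real (L.Fx j M k x) = μ.real (L.Fx j M k x ∩ Good x) + μ.real (L.Fx j M k x \ Good x) :=
      (measureReal_inter_add_sdiff (hGood_m x) (measure_ne_top _ _)).symm
    have h3 : μ.real (L.Fx j M k x \ Good x) = μ.real ((Good x)ᶜ ∩ L.Fx j M k x) := by
      rw [Set.sdiff_eq, Set.inter_comm]
    rw [h3] at h2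
    nlinarith [h1, h2, measureReal_nonneg (μ := μ) (s := L.Fx j M k x)]
  -- Claim D: `Σ_P μ(cyl P) φ(P) ≥ (1 - 3δ) μ(𝒢)`
  have hφ_ge : ∀ P, P ⊆ F →
      ∑ x ∈ OB.filter (fun x => ∃ u ∈ L.ufaceX j M x, u ∈ Aof P),
        (fkLaw Λ (pinW W ↑F ↑P) q).real (L.Fx j M k x) ≤ φ P := by
    intro P hP
    haveI : IsProbabilityMeasure (fkLaw Λ (pinW W ↑F ↑P) q) := isProbabilityMeasure_fkLaw Λ _ hq0
    have hsub : (⋃ x ∈ OB.filter (fun x => ∃ u ∈ L.ufaceX j M x, u ∈ Aof P), L.Fx j M k x) ⊆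
        ⋃ a ∈ Aof P, openConn L.o a := by
      intro ω hω
      simp only [Set.mem_iUnion, exists_prop, Finset.mem_filter] at hω ⊢
      obtain ⟨x, ⟨hxO, u, hu, huA⟩, hFx⟩ := hω
      exact ⟨u, huA, LData.openConn_of_mem_oSeed hwide hxO (LData.Fx_subset_oSeed x hFx) hu⟩
    calc _ = (fkLaw Λ (pinW W ↑F ↑P) q).real
            (⋃ x ∈ OB.filter (fun x => ∃ u ∈ L.ufaceX j M x, u ∈ Aof P), L.Fx j M k x) := by
          rw [measureReal_biUnion_finset]
          · intro x hx x' hx' hne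
            exact LData.Fx_disjoint hne (Finset.mem_filter.1 hx').1 (Finset.mem_filter.1 hx).1
          · intro x hx; exact LData.measurableSet_Fx (Finset.mem_filter.1 hx).1
      _ ≤ φ P := measureReal_mono hsub (measure_ne_top _ _)
  have hD : (1 - 3 * δ) * μ.real (L.Gev j M k) ≤ ∑ P ∈ F.powerset, μ.real (cyl P) * φ P := by
    -- `μ(F_x ∩ Ξ_x) = Σ_{P good for x} μ(cyl P) μ_P(F_x)` (tower property of pinning)
    have hGx : ∀ x ∈ OB, μ.real (L.Fx j M k x ∩ Good x) =
        ∑ P ∈ F.powerset.filter (fun P => ∃ u ∈ L.ufaceX j M x, u ∈ Aof P),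
          μ.real (cyl P) * (fkLaw Λ (pinW W ↑F ↑P) q).real (L.Fx j M k x) := by
      intro x hx
      rw [hμ, hPL.real_inter_eq_sum_pinW W hFD (LData.measurableSet_Fx hx) (hGood_det x)]
      refine Finset.sum_congr ?_ fun P _ => rfl
      ext P
      simp only [Finset.mem_filter, Finset.mem_powerset, hGood, Set.mem_setOf_eq, hAof, and_congr_right_iff]
      intro _
      constructor
      · rintro ⟨u, hu, hg⟩; exact ⟨u, hu, hUS x hx hu, hg⟩
      · rintro ⟨u, hu, -, hg⟩; exact ⟨u, hu, hg⟩
    calc (1 - 3 * δ) * μ.real (L.Gev j M k)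
        = ∑ x ∈ OB, (1 - 3 * δ) * μ.real (L.Fx j M k x) := by
          rw [← LData.biUnion_Fx_eq_Gev, measureReal_biUnion_finset, Finset.mul_sum]
          · intro x hx x' hx' hne; exact LData.Fx_disjoint hne hx' hx
          · intro x hx; exact LData.measurableSet_Fx hx
      _ ≤ ∑ x ∈ OB, μ.real (L.Fx j M k x ∩ Good x) := Finset.sum_le_sum fun x hx => hexch x hx
      _ = ∑ x ∈ OB, ∑ P ∈ F.powerset.filter (fun P => ∃ u ∈ L.ufaceX j M x, u ∈ Aof P),
            μ.real (cyl P) * (fkLaw Λ (pinW W ↑F ↑P) q).real (L.Fx j M k x) :=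
          Finset.sum_congr rfl fun x hx => hGx x hx
      _ = ∑ P ∈ F.powerset, ∑ x ∈ OB.filter (fun x => ∃ u ∈ L.ufaceX j M x, u ∈ Aof P),
            μ.real (cyl P) * (fkLaw Λ (pinW W ↑F ↑P) q).real (L.Fx j M k x) := by
          rw [Finset.sum_comm' (t' := F.powerset)
            (s' := fun P => OB.filter (fun x => ∃ u ∈ L.ufaceX j M x, u ∈ Aof P))]
          intro x P
          simp only [Finset.mem_filter, Finset.mem_powerset]
          tauto
      _ = ∑ P ∈ F.powerset, μ.real (cyl P) *
            ∑ x ∈ OB.filter (fun x => ∃ u ∈ L.ufaceX j M x, u ∈ Aof P),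
              (fkLaw Λ (pinW W ↑F ↑P) q).real (L.Fx j M k x) := by
          refine Finset.sum_congr rfl fun P _ => ?_
          rw [Finset.mul_sum]
      _ ≤ ∑ P ∈ F.powerset, μ.real (cyl P) * φ P :=
          Finset.sum_le_sum fun P hP => mul_le_mul_of_nonneg_left (hφ_ge P (Finset.mem_powerset.1 hP)) measureReal_nonneg
  -- total mass of the cylinders is `1`
  have hcyl_sum : ∑ P ∈ F.powerset, μ.real (cyl P) = 1 := by
    have := hPL.real_eq_sum_localCylinder W hFD (determinedBy_univ (↑F : Set (Sym2 (Site d))))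
    simp only [Set.mem_univ, Finset.filter_true, probReal_univ] at this
    rw [hμ]; exact this.symm
  -- Claim E: the bad patterns have mass `≤ ε/2`
  set Bad := F.powerset.filter (fun P => φ P ≤ 1 - δc) with hBad
  have hφ_le : ∀ P, φ P ≤ 1 := fun P => by
    haveI : IsProbabilityMeasure (fkLaw Λ (pinW W ↑F ↑P) q) := isProbabilityMeasure_fkLaw Λ _ hq0
    exact measureReal_le_one
  have hE : ∑ P ∈ Bad, μ.real (cyl P) ≤ ε / 2 := by
    have hδc0 : 0 < δc := hδ.trans_le hδc
    have h1 : δc * ∑ P ∈ Bad, μ.real (cyl P) ≤ ∑ P ∈ F.powerset, μ.real (cyl P) * (1 - φ P) := by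
      rw [Finset.mul_sum]
      calc ∑ P ∈ Bad, δc * μ.real (cyl P) ≤ ∑ P ∈ Bad, μ.real (cyl P) * (1 - φ P) :=
            Finset.sum_le_sum fun P hP => by
              rw [mul_comm]
              exact mul_le_mul_of_nonneg_left (by have := (Finset.mem_filter.1 hP).2; linarith) measureReal_nonneg
        _ ≤ ∑ P ∈ F.powerset, μ.real (cyl P) * (1 - φ P) :=
            Finset.sum_le_sum_of_subset_of_nonneg (Finset.filter_subset _ _) fun P _ _ =>
              mul_nonneg measureReal_nonneg (by linarith [hφ_le P])
    have h2 : ∑ P ∈ F.powerset, μ.real (cyl P) * (1 - φ P) =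
        1 - ∑ P ∈ F.powerset, μ.real (cyl P) * φ P := by
      simp only [mul_sub, mul_one, Finset.sum_sub_distrib, hcyl_sum]
    have h3 : 1 - ∑ P ∈ F.powerset, μ.real (cyl P) * φ P < 6 * δ := by
      have : (1 - 3 * δ) * (1 - 3 * δ) < (1 - 3 * δ) * μ.real (L.Gev j M k) ∨ 1 - 3 * δ = 0 := by
        rcases eq_or_lt_of_le (sub_nonneg.2 h3δ) with h0 | h0
        · exact Or.inr h0.symm
        · exact Or.inl (mul_lt_mul_of_pos_left hG h0)
      rcases this with h4 | h4
      · nlinarith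
      · have : ∑ P ∈ F.powerset, μ.real (cyl P) * φ P ≥ 0 :=
          Finset.sum_nonneg fun P _ => mul_nonneg measureReal_nonneg (by
            haveI : IsProbabilityMeasure (fkLaw Λ (pinW W ↑F ↑P) q) := isProbabilityMeasure_fkLaw Λ _ hq0
            exact measureReal_nonneg)
        nlinarith
    have h4 : δc * ∑ P ∈ Bad, μ.real (cyl P) ≤ 6 * δ := by linarith
    have h5 : δc * ∑ P ∈ Bad, μ.real (cyl P) ≤ δc * (ε / 2) := by nlinarith
    exact le_of_mul_le_mul_left h5 hδc0
  -- Claim F: on good patterns the gluing applies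
  have hF_good : ∀ P ∈ F.powerset, P ∉ Bad →
      1 - ε / 2 < (fkLaw Λ (pinW W ↑F ↑P) q).real (⋃ t ∈ T, openConn L.o t) := by
    intro P hP hPB
    have hgood : 1 - δc < φ P := by
      by_contra hle; exact hPB (Finset.mem_filter.2 ⟨hP, not_lt.1 hle⟩)
    have hsupp : FinSupp (pinW W ↑F ↑P) L.Sfin := by rw [hFS]; exact hL.finSupp_pinW hSfin ↑P
    refine hC3 _ hsupp (Aof P) ((Finset.filter_subset _ _).trans hSfin) hgood fun a ha => ?_
    have hga := (Finset.mem_filter.1 ha).2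
    linarith
  -- conclusion: total probability over the patterns
  have hmT : MeasurableSet (⋃ t ∈ T, openConn L.o t : Set (BondConfig (Site d))) :=
    Finset.measurableSet_biUnion _ fun t _ => measurableSet_openConn_holds _ _
  have htot := hPL.real_inter_eq_sum_pinW W hFD hmT (determinedBy_univ (↑F : Set (Sym2 (Site d))))
  rw [Set.inter_univ] at htot
  simp only [Set.mem_univ, Finset.filter_true] at htot
  change μ.real (⋃ t ∈ T, openConn L.o t) = ∑ P ∈ F.powerset, μ.real (cyl P) *
    (fkLaw Λ (pinW W ↑F ↑P) q).real (⋃ t ∈ T, openConn L.o t) at htot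
  rw [htot]
  calc 1 - ε < (1 - ε / 2) * (1 - ε / 2) := by nlinarith
    _ ≤ (1 - ε / 2) * ∑ P ∈ F.powerset \ Bad, μ.real (cyl P) := by
        have hnonneg : (0 : ℝ) ≤ 1 - ε / 2 := by linarith
        have : ∑ P ∈ F.powerset \ Bad, μ.real (cyl P) = 1 - ∑ P ∈ Bad, μ.real (cyl P) := by
          have hBsub : Bad ⊆ F.powerset := by rw [hBad]; exact Finset.filter_subset _ _
          rw [← hcyl_sum, ← Finset.sum_sdiff hBsub]; ring
        rw [this]
        exact mul_le_mul_of_nonneg_left (by linarith) hnonneg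
    _ = ∑ P ∈ F.powerset \ Bad, μ.real (cyl P) * (1 - ε / 2) := by
        rw [Finset.mul_sum]; refine Finset.sum_congr rfl fun P _ => mul_comm _ _
    _ ≤ ∑ P ∈ F.powerset \ Bad, μ.real (cyl P) *
          (fkLaw Λ (pinW W ↑F ↑P) q).real (⋃ t ∈ T, openConn L.o t) :=
        Finset.sum_le_sum fun P hP => by
          obtain ⟨hP1, hP2⟩ := Finset.mem_sdiff.1 hP
          exact mul_le_mul_of_nonneg_left (hF_good P hP1 hP2).le measureReal_nonneg
    _ ≤ ∑ P ∈ F.powerset, μ.real (cyl P) *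
          (fkLaw Λ (pinW W ↑F ↑P) q).real (⋃ t ∈ T, openConn L.o t) :=
        Finset.sum_le_sum_of_subset_of_nonneg Finset.sdiff_subset fun P _ _ =>
          mul_nonneg measureReal_nonneg (by
            haveI : IsProbabilityMeasure (fkLaw Λ (pinW W ↑F ↑P) q) := isProbabilityMeasure_fkLaw Λ _ hq0
            exact measureReal_nonneg)

end Summit.CriticalPhenomena.PercolationContinuityZ3.Theorems.FK

end
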